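import Mathlib
import HarnessLib
import Literature.Analysis.Calculus.ParametricCrossingTime
import Summits.NavierStokesRegularity.NavierStokesRegularity.Theorems.PoloidalWindowDoorLrcModEntireBaseWebArclength

/-!
# Route `PoloidalWindowDoor`, item `LrcModEntire` (stmt-NavierStokesRegularity-20428), cell (Q4-sonic, straight, μ < 0) `stub_Q4sonicLineNeg`, case II —
# BRICK B-TWPc, PART T2: THE LOCAL FERMI-FRAME TIME-WEB FUNCTION OVER THE CURVED BASE WEB (one analytic implicit function, no cross-sections)

Cell ns-regularity-ideate, stub-worker seat ns-poloidal-K2-p2 g18 under the LEAD of item 20428 (ns-poloidal-K2-p3 g17/g18);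
`--supports stmt-NavierStokesRegularity-20428 --as helper`.  Memo `Cruxes/LrcModEntire/TOWER-CLOSES-port2g9.md` §D2/§E (B-TWPc), LEAD 2026-08-29T23:13:57Z.

THE POINT.  In case II the webs at time `−1+τ` are handed to us as GRAPHS over the straight hot line: `{s·e + n₀(τ,s,z)·Je + z·e₂}` with the space–time web
function `n₀` real-analytic (`…WebPackageAnalytic.webFunction_analyticAt`).  The tower (§A–§C) is written in the FERMI FRAME of the base web
`γ(s) = s·e + g(s)·Je`, `g := n₀(τ₁,·,0)`, at a base time `τ₁`.  No cross-section analysis is needed to change frames: a horizontal point `P + z·e₂` lies on the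
web of `(τ,z)` iff `⟪P,Je⟫ = n₀(τ, ⟪P,e⟫, z)`; writing `P = γ(s) + m·N(s)` with the (non-normalised, sqrt-free) normal `N(s) = Je − g′(s)·e` this is ONE scalar
analytic equation `n₀(τ, s − m·g′(s), z) = g(s) + m` in the unknown `m`, with `∂_m = −(1 + g′(s)²) ≠ 0` at `m = 0`: the analytic implicit function theorem
(`Literature.Analysis.Calculus.exists_contDiffOn_crossingTime`, `n = ω`) gives the local normal offset `m = ψ(τ,s,z)`.

* ★ `exists_fermiOffset_local` — for `n₀` analytic at `(τ₁, s₀, 0)`: a ball `B` around `(τ₁,s₀,0)`, a window `(−η, η)` and `ψ : ℝ³ → ℝ`, `C^ω` on `B`, with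
  `ψ(τ₁,s₀,0) = 0`, the WEB RELATION `n₀(τ, s − ψ·g′(s), z) = g(s) + ψ` on `B`, UNIQUENESS of the solution in the window, and the PIN `ψ(τ₁,s,0) = 0` on `B`;
* `fermiPoint_eq_webPoint` — the algebra `γ(s) + m·N(s) + z·e₂ = S·e + (g(s) + m)·Je + z·e₂`, `S = s − m·g′(s)` (so under the web relation the Fermi point IS the
  line-frame web point `frameCLM e (S, n₀(τ,S,z), z)`);
* `fermiPoint_eq_unitNormal` — with the unit-speed data of T1 (`…BaseWebArclength.exists_unitSpeed_graph`: `s = φσ`, `rotJ Γ′σ = (1/v)(Je − g′e)`):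
  `Γσ + (m·v(φσ))·rotJ Γ′σ = γ(φσ) + m·N(φσ)`, i.e. the Fermi-frame web function of the consumers is `G₁(τ,σ,z) = ψ(τ,φσ,z)·v(φσ)` (next file, T3).

Class-free.  WHAT THIS IS NOT: not a claim about Navier–Stokes regularity; calculus for the research residue `stub_Q4sonicLineNegIsolated`
(bears_on LADDER-NS N0 via item 20428; items 20428 / 19708 / 27893 OPEN).
-/

noncomputable section

set_option linter.dupNamespace false
set_option linter.style.longLine false

namespace Summit.NavierStokesRegularity.NavierStokesRegularity.Theorems.PoloidalWindowDoorLrcModEntireFermiTimeWebFunction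

open Set Function Filter Topology Metric
open scoped RealInnerProductSpace InnerProductSpace ContDiff
open Summit.NavierStokesRegularity.NavierStokesRegularity.Theorems.PoloidalWindowDoorLrcModEntireSheetFlattenTools
open Summit.NavierStokesRegularity.NavierStokesRegularity.Theorems.PoloidalWindowDoorLrcModEntireRidgeGlobalBranchODE
open Summit.NavierStokesRegularity.NavierStokesRegularity.Theorems.PoloidalWindowDoorLrcModEntireRidgeGlobalBranchFrame
open Summit.NavierStokesRegularity.NavierStokesRegularity.Theorems.PoloidalWindowDoorLrcModEntireBaseWebArclength

/-! ### 1. The local normal offset by the analytic implicit function theorem -/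

/-- ★ **THE LOCAL FERMI OFFSET OF THE WEB OVER THE CURVED BASE WEB.**  `n₀` analytic at `(τ₁, s₀, 0)`; `g′ := deriv (n₀(τ₁,·,0))`.  Then near `(τ₁,s₀,0)`
there is a `C^ω` function `ψ` (the offset of the web of `(τ,z)` from the base web `γ = {s·e + n₀(τ₁,s,0)·Je}` along its normal `N(s) = Je − g′(s)·e`, in units of
`N`) with the web relation, uniqueness in a window, and the pin at the base time. -/
theorem exists_fermiOffset_local {n₀ : ℝ × ℝ × ℝ → ℝ} {τ₁ s₀ : ℝ} (hn₀ : AnalyticAt ℝ n₀ (τ₁, s₀, 0)) :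
    ∃ ε : ℝ, 0 < ε ∧ ∃ η : ℝ, 0 < η ∧ ∃ ψ : ℝ × ℝ × ℝ → ℝ,
      ContDiffOn ℝ ω ψ (ball ((τ₁, s₀, (0 : ℝ)) : ℝ × ℝ × ℝ) ε) ∧ ψ (τ₁, s₀, 0) = 0 ∧
      (∀ x ∈ ball ((τ₁, s₀, (0 : ℝ)) : ℝ × ℝ × ℝ) ε, ψ x ∈ Ioo (-η) η ∧
        n₀ (x.1, x.2.1 - ψ x * deriv (fun s => n₀ (τ₁, s, 0)) x.2.1, x.2.2) = n₀ (τ₁, x.2.1, 0) + ψ x) ∧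
      (∀ x ∈ ball ((τ₁, s₀, (0 : ℝ)) : ℝ × ℝ × ℝ) ε, ∀ m ∈ Ioo (-η) η,
        n₀ (x.1, x.2.1 - m * deriv (fun s => n₀ (τ₁, s, 0)) x.2.1, x.2.2) = n₀ (τ₁, x.2.1, 0) + m → m = ψ x) ∧
      (∀ s : ℝ, ((τ₁, s, (0 : ℝ)) : ℝ × ℝ × ℝ) ∈ ball ((τ₁, s₀, (0 : ℝ)) : ℝ × ℝ × ℝ) ε → ψ (τ₁, s, 0) = 0) := by
  set g : ℝ → ℝ := fun s => n₀ (τ₁, s, 0) with hg_def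
  set x₀ : ℝ × ℝ × ℝ := (τ₁, s₀, 0) with hx₀
  -- the implicit equation `F x m = n₀(τ, s − m g′(s), z) − g(s) − m`
  set F : (ℝ × ℝ × ℝ) → ℝ → ℝ := fun x m => n₀ (x.1, x.2.1 - m * deriv g x.2.1, x.2.2) - n₀ (τ₁, x.2.1, 0) - m with hF
  -- analyticity of the ingredients
  have hι : ∀ s : ℝ, AnalyticAt ℝ (fun s' : ℝ => ((τ₁, s', (0 : ℝ)) : ℝ × ℝ × ℝ)) s := fun s =>
    analyticAt_const.prod (analyticAt_id.prod analyticAt_const)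
  have hgan : AnalyticAt ℝ g s₀ := hn₀.comp_of_eq (hι s₀) rfl
  have hg'an : AnalyticAt ℝ (deriv g) s₀ := hgan.deriv
  -- the inner map `(x, m) ↦ (x.1, x.2.1 − m·g′(x.2.1), x.2.2)` is analytic at `(x₀, 0)` and maps it to `x₀`
  have hP : AnalyticAt ℝ (fun p : (ℝ × ℝ × ℝ) × ℝ => p.1) (x₀, 0) := analyticAt_fst
  have hfst : AnalyticAt ℝ (fun p : (ℝ × ℝ × ℝ) × ℝ => p.1.1) (x₀, 0) :=
    AnalyticAt.comp (g := fun q : ℝ × ℝ × ℝ => q.1) (f := fun p : (ℝ × ℝ × ℝ) × ℝ => p.1) analyticAt_fst hP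
  have hP2 : AnalyticAt ℝ (fun p : (ℝ × ℝ × ℝ) × ℝ => p.1.2) (x₀, 0) :=
    AnalyticAt.comp (g := fun q : ℝ × ℝ × ℝ => q.2) (f := fun p : (ℝ × ℝ × ℝ) × ℝ => p.1) analyticAt_snd hP
  have hs : AnalyticAt ℝ (fun p : (ℝ × ℝ × ℝ) × ℝ => p.1.2.1) (x₀, 0) :=
    AnalyticAt.comp (g := fun q : ℝ × ℝ => q.1) (f := fun p : (ℝ × ℝ × ℝ) × ℝ => p.1.2) analyticAt_fst hP2
  have hz : AnalyticAt ℝ (fun p : (ℝ × ℝ × ℝ) × ℝ => p.1.2.2) (x₀, 0) :=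
    AnalyticAt.comp (g := fun q : ℝ × ℝ => q.2) (f := fun p : (ℝ × ℝ × ℝ) × ℝ => p.1.2) analyticAt_snd hP2
  have hm : AnalyticAt ℝ (fun p : (ℝ × ℝ × ℝ) × ℝ => p.2) (x₀, 0) := analyticAt_snd
  have hg's : AnalyticAt ℝ (fun p : (ℝ × ℝ × ℝ) × ℝ => deriv g p.1.2.1) (x₀, 0) :=
    hg'an.comp_of_eq hs (by simp [hx₀])
  have hinner : AnalyticAt ℝ (fun p : (ℝ × ℝ × ℝ) × ℝ => ((p.1.1, p.1.2.1 - p.2 * deriv g p.1.2.1, p.1.2.2) : ℝ × ℝ × ℝ)) (x₀, 0) :=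
    hfst.prod ((hs.sub (hm.mul hg's)).prod hz)
  have hinner0 : (fun p : (ℝ × ℝ × ℝ) × ℝ => ((p.1.1, p.1.2.1 - p.2 * deriv g p.1.2.1, p.1.2.2) : ℝ × ℝ × ℝ)) (x₀, 0) = (τ₁, s₀, 0) := by
    simp [hx₀]
  have hbase : AnalyticAt ℝ (fun p : (ℝ × ℝ × ℝ) × ℝ => ((τ₁, p.1.2.1, (0 : ℝ)) : ℝ × ℝ × ℝ)) (x₀, 0) :=
    analyticAt_const.prod (hs.prod analyticAt_const)
  have hbase0 : (fun p : (ℝ × ℝ × ℝ) × ℝ => ((τ₁, p.1.2.1, (0 : ℝ)) : ℝ × ℝ × ℝ)) (x₀, 0) = (τ₁, s₀, 0) := by simp [hx₀]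
  have hFan : AnalyticAt ℝ (uncurry F) (x₀, 0) := by
    have h1 : AnalyticAt ℝ (fun p : (ℝ × ℝ × ℝ) × ℝ => n₀ (p.1.1, p.1.2.1 - p.2 * deriv g p.1.2.1, p.1.2.2)) (x₀, 0) :=
      hn₀.comp_of_eq hinner hinner0
    have h2 : AnalyticAt ℝ (fun p : (ℝ × ℝ × ℝ) × ℝ => n₀ (τ₁, p.1.2.1, 0)) (x₀, 0) := hn₀.comp_of_eq hbase hbase0
    have h := (h1.sub h2).sub hm
    refine h.congr (Filter.Eventually.of_forall fun p => ?_)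
    simp [hF, uncurry]
  have hFω : ContDiffAt ℝ ω (uncurry F) (x₀, 0) := hFan.contDiffAt
  -- the transversal derivative `∂_m F(x₀, ·)(0) = −(1 + g′(s₀)²)`
  have hn₀d : DifferentiableAt ℝ n₀ (τ₁, s₀, 0) := hn₀.differentiableAt
  have hg'val : deriv g s₀ = fderiv ℝ n₀ (τ₁, s₀, 0) ((0 : ℝ), (1 : ℝ), (0 : ℝ)) := by
    have hl : HasDerivAt (fun s' : ℝ => ((τ₁, s', (0 : ℝ)) : ℝ × ℝ × ℝ)) ((0 : ℝ), (1 : ℝ), (0 : ℝ)) s₀ := by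
      have h1 := ((hasDerivAt_id s₀).prodMk (hasDerivAt_const s₀ (0 : ℝ)))
      have h2 := (hasDerivAt_const s₀ τ₁).prodMk h1
      simpa using h2
    have hc := hn₀d.hasFDerivAt.comp_hasDerivAt s₀ hl
    exact hc.deriv
  have hspeed : deriv (F x₀) 0 = -(1 + deriv g s₀ ^ 2) := by
    -- `m ↦ n₀(τ₁, s₀ − m g′(s₀), 0) − g(s₀) − m`
    have hl : HasDerivAt (fun m : ℝ => ((τ₁, s₀ - m * deriv g s₀, (0 : ℝ)) : ℝ × ℝ × ℝ)) ((0 : ℝ), -deriv g s₀, (0 : ℝ)) 0 := by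
      have h1 : HasDerivAt (fun m : ℝ => s₀ - m * deriv g s₀) (-deriv g s₀) 0 := by
        simpa using ((hasDerivAt_id (0 : ℝ)).mul_const (deriv g s₀)).const_sub s₀
      have h2 := (hasDerivAt_const (0 : ℝ) τ₁).prodMk (h1.prodMk (hasDerivAt_const (0 : ℝ) (0 : ℝ)))
      exact h2
    have hpt : ((τ₁, s₀ - 0 * deriv g s₀, (0 : ℝ)) : ℝ × ℝ × ℝ) = (τ₁, s₀, 0) := by simp
    have hn₀d' : DifferentiableAt ℝ n₀ (τ₁, s₀ - 0 * deriv g s₀, 0) := by rw [hpt]; exact hn₀d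
    have hc := hn₀d'.hasFDerivAt.comp_hasDerivAt (0 : ℝ) hl
    rw [hpt] at hc
    have hF0 : F x₀ = fun m => n₀ (τ₁, s₀ - m * deriv g s₀, 0) - n₀ (τ₁, s₀, 0) - m := by
      funext m; simp [hF, hx₀]
    rw [hF0]
    have hfull : HasDerivAt (fun m : ℝ => n₀ (τ₁, s₀ - m * deriv g s₀, 0) - n₀ (τ₁, s₀, 0) - m)
        ((fderiv ℝ n₀ (τ₁, s₀, 0)) ((0 : ℝ), -deriv g s₀, (0 : ℝ)) - 1) 0 :=
      (hc.sub_const (n₀ (τ₁, s₀, 0))).sub (hasDerivAt_id (0 : ℝ))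
    rw [hfull.deriv]
    have hlin : fderiv ℝ n₀ (τ₁, s₀, 0) ((0 : ℝ), -deriv g s₀, (0 : ℝ)) = -deriv g s₀ * fderiv ℝ n₀ (τ₁, s₀, 0) ((0 : ℝ), (1 : ℝ), (0 : ℝ)) := by
      have : (((0 : ℝ), -deriv g s₀, (0 : ℝ)) : ℝ × ℝ × ℝ) = (-deriv g s₀) • (((0 : ℝ), (1 : ℝ), (0 : ℝ)) : ℝ × ℝ × ℝ) := by
        simp [Prod.smul_mk]
      rw [this, map_smul, smul_eq_mul]
    rw [hlin, ← hg'val]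
    ring
  have hspeed0 : deriv (F x₀) 0 ≠ 0 := by rw [hspeed]; have := sq_nonneg (deriv g s₀); linarith
  -- the implicit function theorem in the analytic category
  obtain ⟨ε, hε, η, hη, ψ, hψω, hψ0, hψrel, hψuniq⟩ :=
    Literature.Analysis.Calculus.exists_contDiffOn_crossingTime (n := ω) (by simp) (by simp) hFω hspeed0
  have hF00 : F x₀ 0 = 0 := by simp [hF, hx₀]
  refine ⟨ε, hε, η, hη, ψ, hψω, hψ0, fun x hx => ?_, fun x hx m hmw hrel => ?_, fun s hs' => ?_⟩
  · obtain ⟨hwin, hrel⟩ := hψrel x hx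
    refine ⟨by simpa using hwin, ?_⟩
    rw [hF00] at hrel
    have : n₀ (x.1, x.2.1 - ψ x * deriv g x.2.1, x.2.2) - n₀ (τ₁, x.2.1, 0) - ψ x = 0 := by simpa [hF] using hrel
    linarith
  · have hwin : m ∈ Ioo (0 - η) (0 + η) := by simpa using hmw
    refine hψuniq x hx m hwin ?_
    rw [hF00]
    simp only [hF]
    linarith
  · -- the pin: `m = 0` solves the relation at `(τ₁, s, 0)`
    have hwin : (0 : ℝ) ∈ Ioo (0 - η) (0 + η) := by simpa using hη
    have h := hψuniq (τ₁, s, 0) hs' 0 hwin (by rw [hF00]; simp [hF])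
    exact h.symm

/-! ### 2. The Fermi point is the line-frame web point (algebra) -/

/-- **`γ(s) + m·N(s) = S·e + (g(s) + m)·Je`** with `S = s − m·g′(s)`, `γ(s) = s·e + g(s)·Je`, `N(s) = Je − g′(s)·e`. -/
theorem fermiPoint_eq_webPoint (e : EuclideanSpace ℝ (Fin 3)) (s gs g's m z : ℝ) :
    (s • e + gs • Jvec e) + m • (Jvec e - g's • e) + z • e2 = frameCLM e (s - m * g's, gs + m, z) := by
  rw [frameCLM_apply]
  simp only
  module

/-- **The unit normal of the unit-speed base web is `(1/v)·N`**: with `Γ′σ = (1/v)·(e + g′·Je)` (T1), `rotJ Γ′σ = (1/v)·(Je − g′·e)`, hence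
`Γσ + (m·v)·rotJ Γ′σ = γ + m·N` for `v ≠ 0`. -/
theorem fermiPoint_eq_unitNormal {e : EuclideanSpace ℝ (Fin 3)} (he2 : e 2 = 0) (P : EuclideanSpace ℝ (Fin 3)) {v : ℝ} (hv : v ≠ 0) (g' m : ℝ) :
    P + (m * v) • rotJ ((1 / v) • (e + g' • Jvec e)) = P + m • (Jvec e - g' • e) := by
  rw [rotJ_smul_comb he2, smul_sub, smul_sub, smul_smul, smul_smul,
    show m * v * (1 / v) = m by field_simp, show m * v * (1 / v * g') = m * g' by field_simp, mul_smul]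

end Summit.NavierStokesRegularity.NavierStokesRegularity.Theorems.PoloidalWindowDoorLrcModEntireFermiTimeWebFunction

end
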